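import Literature.MathematicalPhysics.QuantumFieldTheory.Balaban1983to89.B15Prop1CoerciveEditionNearRadius

/-!
# `Balaban1983to89.B15Prop1CoerciveEditionNearAtLength` — [Balaban1989LargeFieldI] Prop. 1 p. 194 ∕ [Balaban1989LargeFieldII] pp. 357–359 ∕ [Balaban1985Variational] Thm 1 (8) p. 279:
# THE NEAR-CURRENCY `_ofCoercive` CHAIN OF N12's DIRECT ROAD WITH THE [15]-THEOREM-1 LETTER READ AT EACH INSTANCE's OWN LENGTH `k i` (AT-LENGTH EDITION; no quantification over lengths)

Honest framing: statement-level skeleton of published theorems with citation tags; proofs where landed; nothing here is a claim about the Yang–Mills mass gap.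

Cell `pub-ymgap` (HUMAN RULINGS D-0062 ∕ D-0149), seat `pub-ymgap-dag-n12-c` g32 (R134 seat (a), N12 = [B15], strategy s1, lane owner), the LITERATURE SIDE of the located
item «LOCATED-DIRECT-H15» (dag-n12-d g26; plan of record v0.13.41 (Δ′): «recipe = at-length re-thread … Literature side = lane's pen»); count-neutral helper of K1⁹
`stmt-QuantumFields-27364` (`--kind proof --supports`); N12 NOT discharged; one finite 𝕋⁴ programme at fixed ε; nothing continuum ∕ ℝ⁴ ∕ OS ∕ mass-gap ∕ Clay.
THEOREMS ONLY (0 `def`, 0 `instance`, 0 `sorry`).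

WHY.  The direct road's Literature heads — `B15Prop1CoerciveEditionNearExt` §0–§1 (✓p701805), `B15Prop1CoerciveEditionNearRadius` §2 (✓p735896), `B15Prop1WindowDirectPackageNearRadius`
(✓p736212) — and hence dag-n12-d's Summits cascade T1′–T4′ «DatumScale» display [Balaban1985Variational] Theorem 1 (8) as the CLOSED TORUS-CLASS LETTER `h15T` QUANTIFIED OVER ALL
LENGTHS `k' ≤ m + K` with `LᵏʹM₁ ∣ sitesPerDir 0` (shape (C) of `B15Prop1Thm1GeneralFormShapes`), although every proof reads it exactly ONCE, at the instance's own length `k' := k i`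
(inside `nearValue_letter_of_thm1Guarded(_nearCount)`).  The all-lengths letter is served by the FLOOR-FREE named fact `Node00.VariationalThm1RegSepCoP7M F 2 B₃ a₀ a₁`
(`B15Prop1Thm1GeneralFormAtZSequence.thm1TorusClass_of_variationalThm1RegSepCoP7M`), but NOT by the K0 road's REGISTERED grid-guarded token (`K0V22ZDefs.Prop8StepCoPGridGAt F` ⟹
`Node00.VariationalThm1RegSepCoP7MG F 2 A‴ B₃ a₀ a₁`, dag-n07-e), which serves the letter only AT LENGTHS PASSING ITS GUARD (dag-n12-d `BalabanUVNodesN12Thm1LettersAtLengthOfK0GridG`: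
`thm1LetterT_atLength_of_variationalThm1RegSepCoP7MG_grid`, `exists_thm1LetterT_atLength_of_prop8StepCoPGridGAt`).  THIS FILE re-issues the three h15-reading heads of the near
chain with the letter binder replaced by ITS AT-LENGTH TEXT `h15T : ∀ i, ∀ s : Seq (LʲM₁-cube unions) (k i), <(8)-body at k i>` — byte for byte the letter of dag-n12-d's
`B15Prop1Thm1RowsOfExistsUniqueAtLength` (✓p741118; the (J0′) head's at-length edition) — and ONE call edited per proof.  Token-free, hence blind to which (8)-token K0⁷ finally
registers: any producer of the letter under any length ∕ prefix guard serves the instances passing the guard; the all-lengths letter serves every instance (`fun i => h15T (k i) (hk i) (hdiv i)`).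

CONTENTS.  §1 ★ `nearValue_letter_of_thm1AtLength_nearCount` — (Vn) with the NEAR plaquette count from the AT-LENGTH letter (twin of `…NearExt` §0; the shape-(A) re-index of
`thm1Guarded_of_thm1TorusClass` performed at the one length inside the proof).  §2 `…_atZSeqCoPRecord_ofThm1AtLength_ofCoercive_nearExt` (over the h15-free
`…_ofNearValue_ofCoercive_nearExt` BY NAME) · ★ `…_atZSeqCoPRecord_ofThm1AtLength_ofMinimiserFamily_ofCoercive_nearExt` (twin of `…NearExt` :476, the (J0′) layer).  §3 ★★★
`…_atZSeqCoPRecord_ofThm1AtLength_ofMinimiserFamily_ofCoercive_nearRadius` — the (J0′) minimiser-family head WITH THE CLAUSE AT THE NEAR RADIUS (twin of `…NearRadius` §2 ✓p735896 —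
the head `B15Prop1WindowDirectPackageNearRadius` and T1′ bottom on), proof verbatim with the `_nearExt` head and the (Vn) `have` swapped for §2 ∕ §1.

HONEST SCOPE.  Binder surgery (one letter binder, one call per proof); nothing of Bałaban asserted; (J0′) `hMin`, (1.9) `hcoer`, the [15] letter `h15T` (now at length) remain LETTERS;
count-neutral; NOT a discharge of N12; K0⁷ ∕ K1⁹ NOT closed; counts unmoved; R4 closes only the conditional finite-𝕋⁴ rung `BalabanLadder.UV` — nothing continuum ∕ ℝ⁴ ∕ OS;
the Yang–Mills mass gap (Clay) is NOT proved by any of this.  No `def`, no `instance`, no `sorry`.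

## References
* [Balaban1989LargeFieldI] T. Bałaban, Commun. Math. Phys. 122 (1989) 175–202, (1.74) p. 192, p. 193, Prop. 1 (1.77)–(1.78) p. 194, (1.79) p. 195.
* [Balaban1989LargeFieldII] T. Bałaban, Commun. Math. Phys. 122 (1989) 355–392, (1.2)–(1.6) p. 357, (1.7)–(1.9) p. 358, (1.11)–(1.13), (1.15) p. 359.
* [Balaban1985Variational] T. Bałaban, Commun. Math. Phys. 102 (1985) 277–309, (1) p. 277, (2)–(7) p. 278, Thm 1 (8) p. 279, (181) p. 307, Prop. 9 (190) p. 309.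
* [Balaban1988Convergent] T. Bałaban, Commun. Math. Phys. 119 (1988) 243–285, (2.1) p. 254, (2.12)–(2.14) pp. 256–257, (2.16)–(2.18) p. 257.
* [Balaban1985RegularSpaces] T. Bałaban, Commun. Math. Phys. 98 (1985) 17–51 ∕ «regular spaces» (1.3)–(1.9) p. 77 (the `LʲM₁`-cube partitions).
-/

noncomputable section

open Set Finset Metric Filter
open scoped BigOperators Matrix RealInnerProductSpace Real InnerProductSpace Topology

namespace Literature.MathematicalPhysics.QuantumFieldTheory.Balaban1983to89.B15Prop1CoerciveEditionNearAtLength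

open B15DeterminingSets GaugeField B16Sect1Backgrounds B15Prop1Carrier B8Eq17ClassAkV1 BlockAveraging
open B15Prop1SliceTaylorCalculus B15Prop1IntrinsicAnalyticExt B15Prop1ParametricZeroBranch B15Prop1LocalLettersOfFun B15Prop1IntrinsicOfFun
open B15Prop1IntrinsicOfRecord B15Prop1GradientFromNearValue B15Prop1GradientFromNearValueAtCoPRecord
open B15Prop1AtZSequenceRecord B15Prop1DatumSmall7AtZSequence B15Prop1Thm1GeneralFormAtZSequence B15Prop1Thm1GeneralFormShapes
open B15Prop1JointHolomorphyFromBackground B15Prop1OneSidedIneq17OfFun B15Prop1OneSidedIneq17Edition B15Prop1ValueOfAnyMinimiser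
open B15Prop1JointHolomorphyFromMinimiserFamilyOneSided B15Prop1JointHolomorphyFromMinimiserFamily B15Prop1CoerciveOfFun
open B15Prop1ClosedGuardUniformRadius (plaqLeOn_of_plaqSmallOn forall_of_forall_isCompact_subset)
open B15Prop1AnalyticExtClause (cplxVec cplxSlice cplxSlice_apply norm_cplxSlice norm_cplxVec reSlice anExt anExt_antitone)
open B15Prop1ChartCalculusSU2 (E3)
open T4CubeChartGnomonic (SU2)
open B15Prop1ChartSU2 (su2Chart)
open B15Prop1SliceCoordinates (GaugeSlice ιA freeBonds norm_ιA_apply_le)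
open T4AxialGaugeSmallField (castSite boxPlaqs)
open T4AxialGaugeFixing (TreeOrder boxDepth)
open B7Prop1Explicit (e e_apply)
open B6BondElimination (unitVec)
open B6TreeGaugePoincare (curl)
open B16Eq18Proof (box mem_box)
open B15Extension193 (extend)
open B15ShellGauge193 (shellGauge)
open B5Bounds167Lattice (formDk ofRealCfg)
open B14DomainGeom (IsUnionOfCubes)
open B15Eq112TorusCover (cover)
open B14.Eq213MaximalDomains (side)
open B14.Eq213DetSet B14.Eq216Concrete B15Sect1Instances B15Eq177GaugeInvariance B15Eq177ValueInvariance B15Eq177ValueInvarianceCoDiv B16Sect1Wilson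
open B14.Eq22Determines (blockIter IsBlockUnion)
open Literature.MathematicalPhysics.QuantumFieldTheory.BalabanImbrieJaffe1984to88.BIJ85Eq453GaugeField
open B11Prop6Scheme (Prop4Hyp)
open T4Continuum
open Classical
open B15Prop1CoerciveEdition B15Prop1NearValueOfMinimiserFamily
open B15ShellGauge193Local (dist1_plaqHol_extend_shellGauge_le)
open B15Prop1CoerciveEditionNearExt B15Prop1CoerciveEditionNearRadius B15Prop1AnalyticExtNearRadius
open B15Prop1CriticalAtBoxG0 (treeOrder_G0 tgt_G0_mem)

/-! ## §1 The near-value letter (Vn), near count, from the [15] letter READ AT EACH INSTANCE's OWN LENGTH -/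

section NearCount

/-- ★ **AT-LENGTH edition of `B15Prop1CoerciveEditionNearExt.nearValue_letter_of_thm1Guarded_nearCount`** (✓p701805 §0): the (Vn) letter at print's (1.74) object with the NEAR plaquette
count, from [15] Theorem 1 (8) over NODE 00's torus class of `LʲM₁`-cube unions READ AT THE LENGTH `k i` OF EACH INSTANCE — `h15T : ∀ i, ∀ s : Seq … (k i), …` (dag-n12-d's
`B15Prop1Thm1RowsOfExistsUniqueAtLength` letter text byte for byte; the antecedents `k' ≤ m + K`, `LᵏʹM₁ ∣ sitesPerDir 0` of the all-lengths letter are the displayed instance rows `hk`,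
`hdiv`).  Proof: the original's, the one letter call re-indexed at the length `k i` from `Z_i`'s maximal (2.18) index (cube letters, shape (A)) to the torus-class index (shape (C)) by
`exists_seq_torusClass_of_cubeLetters` + `seqSeparated_iff_of_Ω_eq` (as `thm1Guarded_of_thm1TorusClass` does for all lengths).  Served by ANY producer of the (8)-letter under any length ∕
prefix guard at the instances passing it; by the all-lengths letter at every instance.
[cite: Balaban1989LargeFieldI, (1.74) p.192, p.193, (1.79) p.195; Balaban1985Variational, (1) p.277, (2),(6),(7) p.278, Thm 1 (8) p.279; Balaban1988Convergent, (2.1) p.254,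
p.255, (2.12)–(2.13) pp.256–257, (2.16), (2.18) p.257; Balaban1985RegularSpaces, (1.3)–(1.6) p.77] -/
theorem nearValue_letter_of_thm1AtLength_nearCount {F : T4Family} (ν : Node00.Stage7Numerics) (Kt : ℕ) (hd3 : 3 ≤ (F.P Kt).d) {ι : Type}
    (Z Λ : ι → Set (Site (F.P Kt) 0)) (k : ι → ℕ) (hk0 : ∀ i, 0 < k i) (hk : ∀ i, k i ≤ (F.P Kt).m + (F.P Kt).K)
    (eR : ι → ℝ)
    (lo hi : ι → Fin (F.P Kt).d → ℤ) (n : ι → ℕ) (hn : ∀ i κ, hi i κ ≤ lo i κ + n i)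
    (hbox : ∀ i, pts (k i) (Λ i) = (castSite '' Set.Icc (lo i) (hi i) : Set (Site (F.P Kt) (k i))))
    (hZ : ∀ i, (boxPlaqs (lo i - 1) (hi i + 1) : Set (Plaq (F.P Kt) (k i))) ⊆ plaqsInside (pts (k i) (Z i)))
    (hN5 : ∀ i κ, ((hi i κ - lo i κ + 1).toNat : ℤ) + 5 < (F.P Kt).sitesPerDir (k i))
    (ext : ∀ i, GaugeField (F.P Kt) (k i) SU2 → GaugeField (F.P Kt) (k i) SU2)
    (hext : ∀ i Vk, ext i Vk = extend (pts (k i) (Λ i)) (shellGauge Vk (lo i) (hi i)) Vk)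
    (hlohi : ∀ i, lo i ≤ hi i)
    -- (Gᵃ) geometry of `Z`: a union of `k`-blocks (print's `Z` is a union of `M`-cubes of `T₁^{(k)}`; §4 derives it from the cube letter on the cover)
    (hZblk : ∀ i, IsBlockUnion (k i) (Z i))
    -- print's `M₁ ≥ 2` and the torus divisibility `L^{k}M₁ ∣ 2L^{m+K}` of the `LʲM₁`-cube partitions
    (hM2 : 2 ≤ ν.M₁) (hdiv : ∀ i, side (F.P Kt).L ν.M₁ (k i) ∣ (F.P Kt).sitesPerDir 0)
    -- bookkeeping constants
    {cE B₃ a₀ a₁ cA : ℝ} (hcE0 : 0 ≤ cE) (hcE : ∀ i, 12 * ((F.P Kt).d : ℝ) * ((n i : ℝ) + 2) ^ 2 ≤ cE) (hB₃ : 0 ≤ B₃)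
    (heRa : ∀ i, (cE + 1) * eR i ≤ a₁ ∧ B₃ * ((cE + 1) * eR i) ≤ ν.εreg) (ha₀ : ν.εreg ≤ a₀)
    (hcA : ∀ i, 1 / 2 * (B₃ * (cE + 1) * (F.P Kt).eta 1 ^ 2) ^ 2 * (Nat.card {q : Plaq (F.P Kt) 0 // q ∈ plaqsOf (maxDomT ν.M₁ (Z i) 1)} : ℝ) ≤ cA)
    -- [15] THEOREM 1 (R) = (8) OVER NODE 00's TORUS CLASS (shape (C)), READ AT EACH INSTANCE's OWN LENGTH `k i` (dag-n12-d α's letter text; served by the K0 road's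
    -- grid-guarded (8)-token at instances passing the guard — `BalabanUVNodesN12Thm1LettersAtLengthOfK0GridG` — and by the all-lengths letter at every instance)
    (h15T : ∀ (i : ι) (s : B14.Eq218Concrete.Seq (fun n : ℕ => Node00.unionsOfCubes (F.P Kt) (side (F.P Kt).L ν.M₁ n)) (k i)),
      Node00.Sect2.SeqSeparated ν.M₁ s → 0 < ν.M₁ →
      ∀ (ε₀ : ℝ) (δ : ℕ → ℝ), (∀ j, j ≤ k i → 0 < δ j ∧ δ j ≤ a₁ ∧ B₃ * δ j ≤ ε₀) → (∀ j, j < k i → δ j ≤ 2 * δ (j + 1)) →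
      (∀ j, j < k i → δ (j + 1) ≤ 2 * δ j) → ε₀ ≤ a₀ →
      ∀ W : MSField (F.P Kt) SU2,
        Node00.Sect2.DataSmall7PTop (Node00.avOfRecord F 2 Kt) s.Ω (Node00.suppDomOfRecord F ν Kt s.Ω) (k i) δ W →
        ∀ U₀ : GaugeField (F.P Kt) 0 SU2, IsMinimizer (Node00.avOfRecord F 2 Kt)
            {U | (∀ j, j ≤ k i → PlaqSmallOn (Node00.Sect2.omegaPlaqsTop s.Ω (Node00.suppDomOfRecord F ν Kt s.Ω) j)
                (ε₀ * (F.P Kt).eta j ^ 2) U) ∧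
              Node00.Sect2.CoDivClassOnTop s.Ω (Node00.suppDomOfRecord F ν Kt s.Ω) (k i) ε₀ U}
            (genSet s.Ω (k i)) W U₀ →
          (∀ j, j ≤ k i → PlaqSmallOn (Node00.Sect2.omegaPlaqsTop s.Ω (Node00.suppDomOfRecord F ν Kt s.Ω) j)
              (B₃ * δ j * (F.P Kt).eta j ^ 2) U₀) ∧
            ∀ j, j ≤ k i → Node00.Sect2.CoDivSmallOn (Node00.Sect2.omegaBondsTop s.Ω (Node00.suppDomOfRecord F ν Kt s.Ω) j)
              (B₃ * δ j * (F.P Kt).eta j ^ 3) U₀)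
    : ∀ i ε Vk, 0 < ε → ε ≤ eR i → PlaqSmallOn (plaqsInside (pts (k i) (Z i ∩ (Λ i)ᶜ))) ε Vk →
      wilsonLoc ((plaqsOf (maxDomT ν.M₁ (Z i) 1)).indicator fun _ => (1 : ℝ))
        (bgKZstd (Node00.bgMSCoPOfRecord F 2 ν Kt (k i) (maxDomT ν.M₁ (Z i))) ν.M₁ (Z i) (k i) (ext i Vk)) ≤ cA * ε ^ 2 := by
  intro i ε Vk hε hεR hreg
  have hd : 2 ≤ (F.P Kt).d := by omega
  have hM : 1 ≤ ν.M₁ := le_trans one_le_two hM2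
  have hki : 1 ≤ k i := hk0 i
  -- `Z`'s maximal sequence as a separated (2.18) index, with print's cube letters
  obtain ⟨s, hsΩ, -, hscube, hsep⟩ := exists_seq_maxDomT hM (Z i) (hdiv i)
  have hw1 : s.Ω 1 = maxDomT ν.M₁ (Z i) 1 := hsΩ 1 le_rfl hki
  -- (a) the p. 193 extension is `(cE+1)ε`-small on the `k`-plaquettes inside `Z`
  have hN3 : ∀ κ, hi i κ - lo i κ + 3 < ((F.P Kt).sitesPerDir (k i) : ℤ) := fun κ => by
    have h5 := hN5 i κ
    have hle : lo i κ ≤ hi i κ := hlohi i κ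
    rw [Int.toNat_of_nonneg (by linarith)] at h5
    linarith
  have hδ₀ : 0 < (cE + 1) * ε := by positivity
  have hV : PlaqSmallOn (plaqsInside (pts (k i) (Z i))) ((cE + 1) * ε) (ext i Vk) := by
    intro p hp
    rw [hext]
    have h := (dist1_plaqHol_extend_shellGauge_le hd3 (hlohi i) (hn i) hN3 (hbox i) (hZ i) hε hreg).1 p hp
    calc dist1 (plaqHol (extend (pts (k i) (Λ i)) (shellGauge Vk (lo i) (hi i)) Vk) p)
        ≤ 12 * (F.P Kt).d * (n i + 2) ^ 2 * ε := h
      _ ≤ cE * ε := mul_le_mul_of_nonneg_right (hcE i) hε.le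
      _ < (cE + 1) * ε := by nlinarith
  -- (b) print's (7) for the datum ALONG THE INDEX `s.Ω`
  have h0 : Node00.Sect2.printedPlaqsTop s.Ω (Node00.suppDomOfRecord F ν Kt s.Ω) (k i) ⊆ plaqsInside (Z i) := by
    rw [printedPlaqsTop_congr hki hsΩ, Node00.suppDomOfRecord_congr (F := F) ν Kt hw1]
    exact printedPlaqsTop_maxDomT_subset_plaqsInside hM (hdiv i) hki (k i)
  have hsucc : ∀ m, m + 1 ≤ k i → Node00.Sect2.printedPlaqs s.Ω (k i) (m + 1) ⊆ plaqsInside (pts (m + 1) (Z i)) := by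
    intro m hm
    refine (Node00.Sect2.printedPlaqs_subset_plaqsOf _ _ _).trans ?_
    refine (plaqsOf_mono (genSet_subset_pts_of_one_le s.Ω (k i) (Nat.succ_pos m))).trans ?_
    rw [hsΩ (m + 1) (Nat.succ_pos m) hm]
    exact plaqsOf_pts_maxDomT_subset_plaqsInside hM2 (hdiv i) (Nat.succ_pos m) hm
  have h7 : Node00.Sect2.DataSmall7PTop (Node00.avOfRecord F 2 Kt) s.Ω (Node00.suppDomOfRecord F ν Kt s.Ω) (k i)
      (fun _ => (cE + 1) * ε) (avgFamily (Node00.avOfRecord F 2 Kt) (qsstarGIter0 (k i) (ext i Vk))) :=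
    dataSmall7PTop_avgFamily_qsstarGIter0 hd ExpMeanLog.expMeanLogSU T3DescentFibreTower.expMeanLogSU_E_one rfl (hk i)
      s.Ω _ (Z i) (hZblk i) h0 hsucc (fun _ _ => hδ₀) (ext i Vk) (fun _ _ => hV)
  -- numerics of the thresholds
  have hnum : ∀ j, j ≤ k i → 0 < (cE + 1) * ε ∧ (cE + 1) * ε ≤ a₁ ∧ B₃ * ((cE + 1) * ε) ≤ ν.εreg := fun j _ => by
    obtain ⟨ha, hb⟩ := heRa i
    have h1 : (cE + 1) * ε ≤ (cE + 1) * eR i := mul_le_mul_of_nonneg_left hεR (by linarith)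
    exact ⟨hδ₀, h1.trans ha, (mul_le_mul_of_nonneg_left h1 hB₃).trans hb⟩
  -- (c) the (1.74) class and determining set at `maxDomT ν.M₁ Z` ARE those at the index `s`
  have hreg : Node00.regMSCoPOfRecord F 2 ν Kt (k i) (maxDomT ν.M₁ (Z i)) = Node00.regMSCoPOfRecord F 2 ν Kt (k i) s.Ω :=
    (regMSCoPOfRecord_congr F 2 ν Kt hki hsΩ).symm
  have hB : Bj ν.M₁ (Z i) (k i) = genSet s.Ω (k i) := (genSet_congr hki hsΩ).symm
  rw [bgKZstd_apply, Node00.bgMSCoPOfRecord_U, hreg, hB]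
  by_cases hsol : ∃ U₀, IsMinimizer (Node00.avOfRecord F 2 Kt) (Node00.regMSCoPOfRecord F 2 ν Kt (k i) s.Ω)
      (genSet s.Ω (k i)) (avgFamily (Node00.avOfRecord F 2 Kt) (qsstarGIter0 (k i) (ext i Vk))) U₀
  · have hmin := Node00.isMinimizer_UminOfRecord _ _ hsol
    -- the letter AT THE LENGTH `k i`, re-indexed from `Z_i`'s maximal index (cube letters) to the torus-class index with the same `Ω`
    obtain ⟨s', hΩ'⟩ := exists_seq_torusClass_of_cubeLetters hM s hscube
    have h15i := h15T i s' ((seqSeparated_iff_of_Ω_eq ν.M₁ hΩ').2 hsep)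
    rw [hΩ'] at h15i
    have h8 := h15i hM ν.εreg (fun _ => (cE + 1) * ε) hnum (fun _ _ => by linarith) (fun _ _ => by linarith) ha₀ _ h7 _ hmin
    have h81 : PlaqSmallOn (plaqsOf (maxDomT ν.M₁ (Z i) 1)) (B₃ * ((cE + 1) * ε) * (F.P Kt).eta 1 ^ 2)
        (Node00.UminOfRecord (Node00.avOfRecord F 2 Kt) (Node00.regMSCoPOfRecord F 2 ν Kt (k i) s.Ω)
          (genSet s.Ω (k i)) (avgFamily (Node00.avOfRecord F 2 Kt) (qsstarGIter0 (k i) (ext i Vk)))) := by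
      have h := h8.1 1 hki
      rwa [Node00.Sect2.omegaPlaqsTop_of_ne_zero _ _ one_ne_zero, Node00.omegaPlaqs_of_ne_zero _ one_ne_zero, hw1] at h
    have hδ1 : 0 ≤ B₃ * ((cE + 1) * ε) * (F.P Kt).eta 1 ^ 2 := by positivity
    refine (nearValue_le_of_plaqSmallOn (maxDomT ν.M₁ (Z i) 1) hδ1 _ h81).trans ?_
    have hcard : ((Finset.univ.filter fun p : Plaq (F.P Kt) 0 => p ∈ plaqsOf (maxDomT ν.M₁ (Z i) 1)).card : ℝ) =
        (Nat.card {q : Plaq (F.P Kt) 0 // q ∈ plaqsOf (maxDomT ν.M₁ (Z i) 1)} : ℝ) := by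
      rw [Nat.card_eq_fintype_card, Fintype.card_subtype]
    calc _ = 1 / 2 * (B₃ * (cE + 1) * (F.P Kt).eta 1 ^ 2) ^ 2 * (Nat.card {q : Plaq (F.P Kt) 0 // q ∈ plaqsOf (maxDomT ν.M₁ (Z i) 1)} : ℝ) * ε ^ 2 := by
          rw [hcard]; ring
      _ ≤ cA * ε ^ 2 := mul_le_mul_of_nonneg_right (hcA i) (sq_nonneg ε)
  · rw [Node00.UminOfRecord_of_not _ _ hsol, wilsonLoc_one_cfg]
    have h0' : (0 : ℝ) ≤ 1 / 2 * (B₃ * (cE + 1) * (F.P Kt).eta 1 ^ 2) ^ 2 * (Nat.card {q : Plaq (F.P Kt) 0 // q ∈ plaqsOf (maxDomT ν.M₁ (Z i) 1)} : ℝ) := by positivity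
    nlinarith [sq_nonneg ε, hcA i]

end NearCount

/-! ## §2 The `Z`-sequence and (J0′) minimiser-family layers of the near chain, [15] letter AT LENGTH -/

section AtRecord

/-- **AT-LENGTH edition of `B15Prop1CoerciveEditionNearExt.…_atZSeqCoPRecord_ofThm1Guarded_ofCoercive_nearExt`** (✓p701805 :297; binders VERBATIM but for the [15] letter, now `h15T` at
each instance's length `k i` in NODE 00's torus-class shape): Proposition 1 [IV] with its analytic-extension clause at print's (1.74) object, per instance the background
`Node00.bgMSCoPOfRecord F 2 ν Kt (k i) (maxDomT ν.M₁ (Z i))`, from (J1) `hGj`, (J1ˢ) `hGjS`, (1.9) `hcoer`, `hfar`, the geometry ∕ numerics rows and the AT-LENGTH letter; one line over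
the h15-free `…_ofNearValue_ofCoercive_nearExt` with (Vn) from §1.
[cite: Balaban1989LargeFieldI, (1.74) p.192, Prop. 1 (1.77)–(1.78) p.194 (incl. the last clause), p.193, (1.79) p.195; Balaban1988Convergent, (2.1) p.254, p.255, (2.12)–(2.13)
pp.256–257, (2.16), (2.18) p.257; Balaban1985Variational, (1) p.277, (2),(5),(6),(7) p.278, Thm 1 (8) p.279, Prop. 9 p.309; Balaban1989LargeFieldII, (1.7)–(1.9) p.358, (1.11)
p.358, (1.12)–(1.13) p.359] -/
theorem exists_domain_prop1Printed_lfVarOn_std_su2_box_intrinsic_analytic_atZSeqCoPRecord_ofThm1AtLength_ofCoercive_nearExt {F : T4Family}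
    (ν : Node00.Stage7Numerics) (Kt : ℕ) (hd3 : 3 ≤ (F.P Kt).d) (h0 : 0 < (F.P Kt).d) {ι : Type}
    [hdec : ∀ j, DecidableEq (PBond (F.P Kt) j)] (hcl : hdec = fun _ a b => Classical.propDecidable (a = b))
    (Z Λ : ι → Set (Site (F.P Kt) 0)) (k : ι → ℕ) (M : ι → ℝ) (hk0 : ∀ i, 0 < k i) (hk : ∀ i, k i ≤ (F.P Kt).m + (F.P Kt).K)
    (eR : ι → ℝ) (heR : ∀ i, 0 < eR i)
    (T : ∀ i, Finset (PBond (F.P Kt) (k i)))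
    (lo hi : ι → Fin (F.P Kt).d → ℤ) (n : ι → ℕ) (hn : ∀ i κ, hi i κ ≤ lo i κ + n i) (hN : ∀ i, n i + 2 < (F.P Kt).sitesPerDir (k i))
    (hbox : ∀ i, pts (k i) (Λ i) = (castSite '' Set.Icc (lo i) (hi i) : Set (Site (F.P Kt) (k i))))
    (hZ : ∀ i, (boxPlaqs (lo i - 1) (hi i + 1) : Set (Plaq (F.P Kt) (k i))) ⊆ plaqsInside (pts (k i) (Z i)))
    (hTG0 : ∀ i, T i = (box (fun κ => (hi i κ - lo i κ + 1).toNat) (lo i)).image fun x =>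
      (⟨castSite (x - unitVec ⟨0, h0⟩), ⟨0, h0⟩⟩ : PBond (F.P Kt) (k i)))
    (hN5 : ∀ i κ, ((hi i κ - lo i κ + 1).toNat : ℤ) + 5 < (F.P Kt).sitesPerDir (k i))
    (ext : ∀ i, GaugeField (F.P Kt) (k i) SU2 → GaugeField (F.P Kt) (k i) SU2)
    (hext : ∀ i Vk, ext i Vk = extend (pts (k i) (Λ i)) (shellGauge Vk (lo i) (hi i)) Vk)
    (hlohi : ∀ i, lo i ≤ hi i)
    {γ cJ bx : ℝ} (hγ : 0 < γ) (hcJ : 0 ≤ cJ) (hbx : 0 ≤ bx)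
    (hbxM : ∀ i, 12 * ((F.P Kt).d : ℝ) * ((n i : ℝ) + 2) ^ 2 ≤ bx * (M i) ^ 2)
    {R 𝓐 𝓐S : ι → ℝ} (hM : ∀ i, 1 ≤ (M i)) (hR : ∀ i, 0 < R i) (h𝓐 : ∀ i, 0 ≤ 𝓐 i)
    -- (J1) the JOINT holomorphic extension of print's function in the datum perturbation and the field
    (hGj : ∀ i Vk, PlaqSmallOn (plaqsInside (pts (k i) (Z i ∩ (Λ i)ᶜ))) (eR i) Vk →
      ∃ 𝒢 : VecField (F.P Kt) (k i) (EuclideanSpace ℂ (Fin 3)) × VecField (F.P Kt) (k i) (EuclideanSpace ℂ (Fin 3)) → ℂ,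
        DifferentiableOn ℂ 𝒢 (ball 0 (R i)) ∧
        (∀ z ∈ ball (0 : VecField (F.P Kt) (k i) (EuclideanSpace ℂ (Fin 3)) × VecField (F.P Kt) (k i) (EuclideanSpace ℂ (Fin 3))) (R i), ‖𝒢 z‖ ≤ 𝓐 i) ∧
        ∀ p B' : VecField (F.P Kt) (k i) E3, ‖p‖ < R i → ‖B'‖ < R i →
          𝒢 (cplxVec p, cplxVec B') =
            ((fun177std (Node00.bgMSCoPOfRecord F 2 ν Kt (k i) (maxDomT ν.M₁ (Z i))) ν.M₁ (Z i) (k i)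
              (expMul su2Chart B' (ext i (expMul su2Chart p Vk))) : ℝ) : ℂ))
    -- (J1ˢ) the JOINT holomorphic extension of the NEAR value of (1.77), bounded by `𝓐S i` — census U3: the near count's currency; served by (J0′) via
    -- `B15Prop1NearValueOfMinimiserFamily.jointHolomorphic_nearValue_bgMSCoPOfRecord_of_minimiserFamily` with `𝓐S i = #plaqsOf(Ω₁(Z_i))·(1+8𝓐₀ i⁴)`
    (hGjS : ∀ i Vk, PlaqSmallOn (plaqsInside (pts (k i) (Z i ∩ (Λ i)ᶜ))) (eR i) Vk →
      ∃ 𝒢S : VecField (F.P Kt) (k i) (EuclideanSpace ℂ (Fin 3)) × VecField (F.P Kt) (k i) (EuclideanSpace ℂ (Fin 3)) → ℂ,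
        DifferentiableOn ℂ 𝒢S (ball 0 (R i)) ∧
        (∀ z ∈ ball (0 : VecField (F.P Kt) (k i) (EuclideanSpace ℂ (Fin 3)) × VecField (F.P Kt) (k i) (EuclideanSpace ℂ (Fin 3))) (R i), ‖𝒢S z‖ ≤ 𝓐S i) ∧
        ∀ p B' : VecField (F.P Kt) (k i) E3, ‖p‖ < R i → ‖B'‖ < R i →
          𝒢S (cplxVec p, cplxVec B') =
            ((wilsonLoc ((plaqsOf (maxDomT ν.M₁ (Z i) 1)).indicator fun _ => (1 : ℝ))
              (bgKZstd (Node00.bgMSCoPOfRecord F 2 ν Kt (k i) (maxDomT ν.M₁ (Z i))) ν.M₁ (Z i) (k i)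
                (expMul su2Chart B' (ext i (expMul su2Chart p Vk)))) : ℝ) : ℂ))
    -- (L2) = (1.9) p.358 AS THE LETTER: coercivity of the slice Hessian `D(∇ sliceFn)(0)` at `eR`-regular data (dag-n12-c's `hcoer`; replaces `{γ₀} h17 hsm hγle`)
    (hcoer : ∀ i Vk, PlaqSmallOn (plaqsInside (pts (k i) (Z i ∩ (Λ i)ᶜ))) (eR i) Vk → ∀ X : GaugeSlice (pts (k i) (Λ i)) (T i) E3,
      γ / (M i) ^ 5 * ‖X‖ ^ 2 ≤ ⟪X, (fderiv ℝ (rGrad (pts (k i) (Λ i)) (T i)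
              (sliceFn (pts (k i) (Λ i)) (T i)
                (fun177std (Node00.bgMSCoPOfRecord F 2 ν Kt (k i) (maxDomT ν.M₁ (Z i))) ν.M₁ (Z i) (k i)) (ext i Vk))) 0) X⟫)
    -- the geometric letter: the k-blocks over the bonds meeting `Λ^{(k)}` lie inside `Ω₁(Z)` (print: `Λ` deep inside `Z`)
    (hfar : ∀ i (b : PBond (F.P Kt) 0), b.src ∉ maxDomT ν.M₁ (Z i) 1 →
      (⟨blockIter (k i) b.src, b.dir⟩ : PBond (F.P Kt) (k i)) ∉ bondsOf (pts (k i) (Λ i)))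
    -- (Gᵃ) geometry of `Z`: a union of `k`-blocks (print's `Z` is a union of `M`-cubes of `T₁^{(k)}`; §4 derives it from the cube letter on the cover)
    (hZblk : ∀ i, IsBlockUnion (k i) (Z i))
    -- print's `M₁ ≥ 2` and the torus divisibility `L^{k}M₁ ∣ 2L^{m+K}` of the `LʲM₁`-cube partitions
    (hM2 : 2 ≤ ν.M₁) (hdiv : ∀ i, side (F.P Kt).L ν.M₁ (k i) ∣ (F.P Kt).sitesPerDir 0)
    -- bookkeeping constants
    {cE B₃ a₀ a₁' cA : ℝ} (hcE0 : 0 ≤ cE) (hcE : ∀ i, 12 * ((F.P Kt).d : ℝ) * ((n i : ℝ) + 2) ^ 2 ≤ cE) (hB₃ : 0 ≤ B₃)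
    (heRa : ∀ i, (cE + 1) * eR i ≤ a₁' ∧ B₃ * ((cE + 1) * eR i) ≤ ν.εreg) (ha₀ : ν.εreg ≤ a₀)
    (hcA : ∀ i, 1 / 2 * (B₃ * (cE + 1) * (F.P Kt).eta 1 ^ 2) ^ 2 * (Nat.card {q : Plaq (F.P Kt) 0 // q ∈ plaqsOf (maxDomT ν.M₁ (Z i) 1)} : ℝ) ≤ cA)
    -- [15] THEOREM 1 (R) = (8) OVER NODE 00's TORUS CLASS (shape (C)), READ AT EACH INSTANCE's OWN LENGTH `k i` (see `nearValue_letter_of_thm1AtLength_nearCount`)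
    (h15T : ∀ (i : ι) (s : B14.Eq218Concrete.Seq (fun n : ℕ => Node00.unionsOfCubes (F.P Kt) (side (F.P Kt).L ν.M₁ n)) (k i)),
      Node00.Sect2.SeqSeparated ν.M₁ s → 0 < ν.M₁ →
      ∀ (ε₀ : ℝ) (δ : ℕ → ℝ), (∀ j, j ≤ k i → 0 < δ j ∧ δ j ≤ a₁' ∧ B₃ * δ j ≤ ε₀) → (∀ j, j < k i → δ j ≤ 2 * δ (j + 1)) →
      (∀ j, j < k i → δ (j + 1) ≤ 2 * δ j) → ε₀ ≤ a₀ →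
      ∀ W : MSField (F.P Kt) SU2,
        Node00.Sect2.DataSmall7PTop (Node00.avOfRecord F 2 Kt) s.Ω (Node00.suppDomOfRecord F ν Kt s.Ω) (k i) δ W →
        ∀ U₀ : GaugeField (F.P Kt) 0 SU2, IsMinimizer (Node00.avOfRecord F 2 Kt)
            {U | (∀ j, j ≤ k i → PlaqSmallOn (Node00.Sect2.omegaPlaqsTop s.Ω (Node00.suppDomOfRecord F ν Kt s.Ω) j)
                (ε₀ * (F.P Kt).eta j ^ 2) U) ∧
              Node00.Sect2.CoDivClassOnTop s.Ω (Node00.suppDomOfRecord F ν Kt s.Ω) (k i) ε₀ U}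
            (genSet s.Ω (k i)) W U₀ →
          (∀ j, j ≤ k i → PlaqSmallOn (Node00.Sect2.omegaPlaqsTop s.Ω (Node00.suppDomOfRecord F ν Kt s.Ω) j)
              (B₃ * δ j * (F.P Kt).eta j ^ 2) U₀) ∧
            ∀ j, j ≤ k i → Node00.Sect2.CoDivSmallOn (Node00.Sect2.omegaBondsTop s.Ω (Node00.suppDomOfRecord F ν Kt s.Ω) j)
              (B₃ * δ j * (F.P Kt).eta j ^ 3) U₀)
    (hcJ' : ∀ i, 2 * cA * eR i / R i + 2 * 𝓐S i / (R i * eR i) ≤ cJ)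
    : ∃ a₁ : ι → ℝ, (∀ i, 0 < a₁ i) ∧
      B15.Prop1Printed (lfVarOn su2Chart fun i =>
        InstOn.std (Node00.bgMSCoPOfRecord F 2 ν Kt (k i) (maxDomT ν.M₁ (Z i))) ν.M₁ (Z i) (Λ i) (k i) (M i) (a₁ i)
          (anExt (pts (k i) (Λ i)) (T i)
            (fun177std (Node00.bgMSCoPOfRecord F 2 ν Kt (k i) (maxDomT ν.M₁ (Z i))) ν.M₁ (Z i) (k i)) (ext i)
            (min (1 / 2) (min (R i / 8) (γ / (M i) ^ 5 * (R i / 2) ^ 2 / (48 * (4 * 𝓐 i / R i + 1))))))) :=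
  exists_domain_prop1Printed_lfVarOn_std_su2_box_intrinsic_analytic_atZSeqCoPRecord_ofNearValue_ofCoercive_nearExt ν Kt hd3 h0 hcl Z Λ k M hk0 hk eR heR
    T lo hi n hn hN hbox hZ hTG0 hN5 ext hext hlohi hγ hcJ hbx hbxM hM hR h𝓐 hGj hGjS hcoer hfar
    (nearValue_letter_of_thm1AtLength_nearCount ν Kt hd3 Z Λ k hk0 hk eR lo hi n hn hbox hZ hN5 ext hext hlohi hZblk hM2 hdiv hcE0 hcE hB₃
      heRa ha₀ hcA h15T) hcJ'

/-- ★ **AT-LENGTH edition of `B15Prop1CoerciveEditionNearExt.…_atZSeqCoPRecord_ofThm1TorusClass_ofMinimiserFamily_ofCoercive_nearExt`** (✓p701805 :476, the (J0′) layer; binders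
VERBATIM but for the [15] letter, now `h15T` at each instance's length `k i`): (J1) and (J1ˢ) both derived from (J0′) `hMin` (`jointHolomorphic_fun177std_bgMSCoPOfRecord_of_minimiserFamily`,
`jointHolomorphic_nearValue_bgMSCoPOfRecord_of_minimiserFamily`); `hcJ'` in the near count; the clause radius still at the TOTAL count (the near radius is §3).  One application of
`…_ofThm1AtLength_ofCoercive_nearExt`.
[cite: Balaban1989LargeFieldI, (1.74) p.192, Prop. 1 (1.77)–(1.78) p.194 (incl. the last clause), (1.79) p.195; Balaban1989LargeFieldII, (1.7)–(1.9) p.358, (1.12)–(1.13) p.359;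
Balaban1985Variational, Thm 1 (8) p.279, Prop. 9 (190) p.309; Balaban1988Convergent, (2.12)–(2.14) pp.256–257] -/
theorem exists_domain_prop1Printed_lfVarOn_std_su2_box_intrinsic_analytic_atZSeqCoPRecord_ofThm1AtLength_ofMinimiserFamily_ofCoercive_nearExt {F : T4Family}
    (ν : Node00.Stage7Numerics) (Kt : ℕ) (hd3 : 3 ≤ (F.P Kt).d) (h0 : 0 < (F.P Kt).d) {ι : Type}
    [hdec : ∀ j, DecidableEq (PBond (F.P Kt) j)] (hcl : hdec = fun _ a b => Classical.propDecidable (a = b))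
    (Z Λ : ι → Set (Site (F.P Kt) 0)) (k : ι → ℕ) (M : ι → ℝ) (hk0 : ∀ i, 0 < k i) (hk : ∀ i, k i ≤ (F.P Kt).m + (F.P Kt).K)
    (eR : ι → ℝ) (heR : ∀ i, 0 < eR i)
    (T : ∀ i, Finset (PBond (F.P Kt) (k i)))
    (lo hi : ι → Fin (F.P Kt).d → ℤ) (n : ι → ℕ) (hn : ∀ i κ, hi i κ ≤ lo i κ + n i) (hN : ∀ i, n i + 2 < (F.P Kt).sitesPerDir (k i))
    (hbox : ∀ i, pts (k i) (Λ i) = (castSite '' Set.Icc (lo i) (hi i) : Set (Site (F.P Kt) (k i))))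
    (hZ : ∀ i, (boxPlaqs (lo i - 1) (hi i + 1) : Set (Plaq (F.P Kt) (k i))) ⊆ plaqsInside (pts (k i) (Z i)))
    (hTG0 : ∀ i, T i = (box (fun κ => (hi i κ - lo i κ + 1).toNat) (lo i)).image fun x =>
      (⟨castSite (x - unitVec ⟨0, h0⟩), ⟨0, h0⟩⟩ : PBond (F.P Kt) (k i)))
    (hN5 : ∀ i κ, ((hi i κ - lo i κ + 1).toNat : ℤ) + 5 < (F.P Kt).sitesPerDir (k i))
    (ext : ∀ i, GaugeField (F.P Kt) (k i) SU2 → GaugeField (F.P Kt) (k i) SU2)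
    (hext : ∀ i Vk, ext i Vk = extend (pts (k i) (Λ i)) (shellGauge Vk (lo i) (hi i)) Vk)
    (hlohi : ∀ i, lo i ≤ hi i)
    {γ cJ bx : ℝ} (hγ : 0 < γ) (hcJ : 0 ≤ cJ) (hbx : 0 ≤ bx)
    (hbxM : ∀ i, 12 * ((F.P Kt).d : ℝ) * ((n i : ℝ) + 2) ^ 2 ≤ bx * (M i) ^ 2)
    {R 𝓐₀ : ι → ℝ} (hM : ∀ i, 1 ≤ (M i)) (hR : ∀ i, 0 < R i) (h𝓐₀ : ∀ i, 0 ≤ 𝓐₀ i)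
    -- (J0′) ONE family along the chart family with ℂ-differentiable bounded matrix entries which at every real point IS SOME (2.12) MINIMISER of that
    -- point's datum in the class of record — print's object `U_k(V′)` of [15] Prop. 9 (190); intrinsic (not pinned to the selector `UminOfRecord`)
    (hMin : ∀ i Vk, PlaqSmallOn (plaqsInside (pts (k i) (Z i ∩ (Λ i)ᶜ))) (eR i) Vk →
      ∃ Ũ : VecField (F.P Kt) (k i) (EuclideanSpace ℂ (Fin 3)) × VecField (F.P Kt) (k i) (EuclideanSpace ℂ (Fin 3)) →
          PBond (F.P Kt) 0 → Matrix (Fin 2) (Fin 2) ℂ,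
        (∀ b a c, DifferentiableOn ℂ (fun z => Ũ z b a c) (ball 0 (R i))) ∧
        (∀ z ∈ ball (0 : VecField (F.P Kt) (k i) (EuclideanSpace ℂ (Fin 3)) × VecField (F.P Kt) (k i) (EuclideanSpace ℂ (Fin 3))) (R i),
          ∀ b a c, ‖Ũ z b a c‖ ≤ 𝓐₀ i) ∧
        ∀ p B' : VecField (F.P Kt) (k i) E3, ‖p‖ < R i → ‖B'‖ < R i → ∃ U' : GaugeField (F.P Kt) 0 SU2,
          (∀ b, Ũ (cplxVec p, cplxVec B') b = ((U' b : SU2) : Matrix (Fin 2) (Fin 2) ℂ)) ∧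
            IsMinimizer (Node00.avOfRecord F 2 Kt) (Node00.regMSCoPOfRecord F 2 ν Kt (k i) (maxDomT ν.M₁ (Z i))) (Bj ν.M₁ (Z i) (k i))
              (avgFamily (Node00.avOfRecord F 2 Kt) (qsstarGIter0 (k i) (expMul su2Chart B' (ext i (expMul su2Chart p Vk))))) U')
    -- (L2) = (1.9) p.358 AS THE LETTER: coercivity of the slice Hessian `D(∇ sliceFn)(0)` at `eR`-regular data (dag-n12-c's `hcoer`; replaces `{γ₀} h17 hsm hγle`)
    (hcoer : ∀ i Vk, PlaqSmallOn (plaqsInside (pts (k i) (Z i ∩ (Λ i)ᶜ))) (eR i) Vk → ∀ X : GaugeSlice (pts (k i) (Λ i)) (T i) E3,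
      γ / (M i) ^ 5 * ‖X‖ ^ 2 ≤ ⟪X, (fderiv ℝ (rGrad (pts (k i) (Λ i)) (T i)
              (sliceFn (pts (k i) (Λ i)) (T i)
                (fun177std (Node00.bgMSCoPOfRecord F 2 ν Kt (k i) (maxDomT ν.M₁ (Z i))) ν.M₁ (Z i) (k i)) (ext i Vk))) 0) X⟫)
    -- the geometric letter: the k-blocks over the bonds meeting `Λ^{(k)}` lie inside `Ω₁(Z)`
    (hfar : ∀ i (b : PBond (F.P Kt) 0), b.src ∉ maxDomT ν.M₁ (Z i) 1 →
      (⟨blockIter (k i) b.src, b.dir⟩ : PBond (F.P Kt) (k i)) ∉ bondsOf (pts (k i) (Λ i)))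
    -- (Gᵃ) geometry of `Z`: a union of `k`-blocks
    (hZblk : ∀ i, IsBlockUnion (k i) (Z i))
    -- print's `M₁ ≥ 2` and the torus divisibility `L^{k}M₁ ∣ 2L^{m+K}`
    (hM2 : 2 ≤ ν.M₁) (hdiv : ∀ i, side (F.P Kt).L ν.M₁ (k i) ∣ (F.P Kt).sitesPerDir 0)
    -- bookkeeping constants
    {cE B₃ a₀ a₁' cA : ℝ} (hcE0 : 0 ≤ cE) (hcE : ∀ i, 12 * ((F.P Kt).d : ℝ) * ((n i : ℝ) + 2) ^ 2 ≤ cE) (hB₃ : 0 ≤ B₃)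
    (heRa : ∀ i, (cE + 1) * eR i ≤ a₁' ∧ B₃ * ((cE + 1) * eR i) ≤ ν.εreg) (ha₀ : ν.εreg ≤ a₀)
    (hcA : ∀ i, 1 / 2 * (B₃ * (cE + 1) * (F.P Kt).eta 1 ^ 2) ^ 2 * (Nat.card {q : Plaq (F.P Kt) 0 // q ∈ plaqsOf (maxDomT ν.M₁ (Z i) 1)} : ℝ) ≤ cA)
    -- [15] THEOREM 1 (R) = (8) OVER NODE 00's TORUS CLASS (shape (C)), READ AT EACH INSTANCE's OWN LENGTH `k i`
    (h15T : ∀ (i : ι) (s : B14.Eq218Concrete.Seq (fun n : ℕ => Node00.unionsOfCubes (F.P Kt) (side (F.P Kt).L ν.M₁ n)) (k i)),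
      Node00.Sect2.SeqSeparated ν.M₁ s → 0 < ν.M₁ →
      ∀ (ε₀ : ℝ) (δ : ℕ → ℝ), (∀ j, j ≤ k i → 0 < δ j ∧ δ j ≤ a₁' ∧ B₃ * δ j ≤ ε₀) → (∀ j, j < k i → δ j ≤ 2 * δ (j + 1)) →
      (∀ j, j < k i → δ (j + 1) ≤ 2 * δ j) → ε₀ ≤ a₀ →
      ∀ W : MSField (F.P Kt) SU2,
        Node00.Sect2.DataSmall7PTop (Node00.avOfRecord F 2 Kt) s.Ω (Node00.suppDomOfRecord F ν Kt s.Ω) (k i) δ W →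
        ∀ U₀ : GaugeField (F.P Kt) 0 SU2, IsMinimizer (Node00.avOfRecord F 2 Kt)
            {U | (∀ j, j ≤ k i → PlaqSmallOn (Node00.Sect2.omegaPlaqsTop s.Ω (Node00.suppDomOfRecord F ν Kt s.Ω) j)
                (ε₀ * (F.P Kt).eta j ^ 2) U) ∧
              Node00.Sect2.CoDivClassOnTop s.Ω (Node00.suppDomOfRecord F ν Kt s.Ω) (k i) ε₀ U}
            (genSet s.Ω (k i)) W U₀ →
          (∀ j, j ≤ k i → PlaqSmallOn (Node00.Sect2.omegaPlaqsTop s.Ω (Node00.suppDomOfRecord F ν Kt s.Ω) j)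
              (B₃ * δ j * (F.P Kt).eta j ^ 2) U₀) ∧
            ∀ j, j ≤ k i → Node00.Sect2.CoDivSmallOn (Node00.Sect2.omegaBondsTop s.Ω (Node00.suppDomOfRecord F ν Kt s.Ω) j)
              (B₃ * δ j * (F.P Kt).eta j ^ 3) U₀)
    (hcJ' : ∀ i, 2 * cA * eR i / R i + 2 * ((Nat.card {q : Plaq (F.P Kt) 0 // q ∈ plaqsOf (maxDomT ν.M₁ (Z i) 1)} : ℝ) * (1 + 8 * 𝓐₀ i ^ 4)) / (R i * eR i) ≤ cJ)
    : ∃ a₁ : ι → ℝ, (∀ i, 0 < a₁ i) ∧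
      B15.Prop1Printed (lfVarOn su2Chart fun i =>
        InstOn.std (Node00.bgMSCoPOfRecord F 2 ν Kt (k i) (maxDomT ν.M₁ (Z i))) ν.M₁ (Z i) (Λ i) (k i) (M i) (a₁ i)
          (anExt (pts (k i) (Λ i)) (T i)
            (fun177std (Node00.bgMSCoPOfRecord F 2 ν Kt (k i) (maxDomT ν.M₁ (Z i))) ν.M₁ (Z i) (k i)) (ext i)
            (min (1 / 2) (min (R i / 8) (γ / (M i) ^ 5 * (R i / 2) ^ 2 /
              (48 * (4 * ((Fintype.card (Plaq (F.P Kt) 0) : ℝ) * (1 + 8 * 𝓐₀ i ^ 4)) / R i + 1))))))) :=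
  exists_domain_prop1Printed_lfVarOn_std_su2_box_intrinsic_analytic_atZSeqCoPRecord_ofThm1AtLength_ofCoercive_nearExt ν Kt hd3 h0 hcl Z Λ k M hk0 hk
    eR heR T lo hi n hn hN hbox hZ hTG0 hN5 ext hext hlohi hγ hcJ hbx hbxM
    (𝓐 := fun i => (Fintype.card (Plaq (F.P Kt) 0) : ℝ) * (1 + 8 * 𝓐₀ i ^ 4))
    (𝓐S := fun i => (Nat.card {q : Plaq (F.P Kt) 0 // q ∈ plaqsOf (maxDomT ν.M₁ (Z i) 1)} : ℝ) * (1 + 8 * 𝓐₀ i ^ 4))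
    hM hR (fun i => by positivity)
    (fun i Vk hV => jointHolomorphic_fun177std_bgMSCoPOfRecord_of_minimiserFamily ν Kt (k i) (maxDomT ν.M₁ (Z i)) ν.M₁ (Z i) (k i) (ext i) Vk
      (hMin i Vk hV))
    (fun i Vk hV => jointHolomorphic_nearValue_bgMSCoPOfRecord_of_minimiserFamily ν Kt (k i) (maxDomT ν.M₁ (Z i)) ν.M₁ (Z i) (k i) (hk0 i) (ext i) Vk
      (h𝓐₀ i) (hMin i Vk hV))
    hcoer hfar hZblk hM2 hdiv hcE0 hcE hB₃ heRa ha₀ hcA h15T hcJ'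

end AtRecord

/-! ## §3 The (J0′) minimiser-family head WITH THE CLAUSE AT THE NEAR RADIUS, [15] letter AT LENGTH (the head `B15Prop1WindowDirectPackageNearRadius` and T1′ bottom on) -/

section AtRecordNearRadius

/-- ★★★ **AT-LENGTH edition of `B15Prop1CoerciveEditionNearRadius.…_atZSeqCoPRecord_ofThm1TorusClass_ofMinimiserFamily_ofCoercive_nearRadius`** (✓p735896 §2; binders VERBATIM but for
the [15] letter, now `h15T : ∀ i, <(8)-body at the length k i>`; SAME conclusion — the analytic-extension clause's radius reads the NEAR count `#plaqsOf(Ω₁(Z_i))·(1+8𝓐₀ i⁴)`).  Proof: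
the original's VERBATIM with the `_nearExt` head and the (Vn) `have` taken from §2 ∕ §1 (the two places the letter is read, both at `k' := k i`).
[cite: Balaban1989LargeFieldI, (1.74) p.192, Prop. 1 (1.77)–(1.78) p.194 (incl. the last clause), (1.79) p.195; Balaban1989LargeFieldII, (1.2)–(1.6) p.357, (1.7)–(1.9) p.358, (1.12)–(1.13) p.359, (1.15) p.359;
Balaban1985Variational, Thm 1 (8) p.279, (181) p.307, Prop. 9 (190) p.309; Balaban1988Convergent, (1.12) p.248, (2.12)–(2.14) pp.256–257] -/
theorem exists_domain_prop1Printed_lfVarOn_std_su2_box_intrinsic_analytic_atZSeqCoPRecord_ofThm1AtLength_ofMinimiserFamily_ofCoercive_nearRadius {F : T4Family}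
    (ν : Node00.Stage7Numerics) (Kt : ℕ) (hd3 : 3 ≤ (F.P Kt).d) (h0 : 0 < (F.P Kt).d) {ι : Type}
    [hdec : ∀ j, DecidableEq (PBond (F.P Kt) j)] (hcl : hdec = fun _ a b => Classical.propDecidable (a = b))
    (Z Λ : ι → Set (Site (F.P Kt) 0)) (k : ι → ℕ) (M : ι → ℝ) (hk0 : ∀ i, 0 < k i) (hk : ∀ i, k i ≤ (F.P Kt).m + (F.P Kt).K)
    (eR : ι → ℝ) (heR : ∀ i, 0 < eR i)
    (T : ∀ i, Finset (PBond (F.P Kt) (k i)))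
    (lo hi : ι → Fin (F.P Kt).d → ℤ) (n : ι → ℕ) (hn : ∀ i κ, hi i κ ≤ lo i κ + n i) (hN : ∀ i, n i + 2 < (F.P Kt).sitesPerDir (k i))
    (hbox : ∀ i, pts (k i) (Λ i) = (castSite '' Set.Icc (lo i) (hi i) : Set (Site (F.P Kt) (k i))))
    (hZ : ∀ i, (boxPlaqs (lo i - 1) (hi i + 1) : Set (Plaq (F.P Kt) (k i))) ⊆ plaqsInside (pts (k i) (Z i)))
    (hTG0 : ∀ i, T i = (box (fun κ => (hi i κ - lo i κ + 1).toNat) (lo i)).image fun x =>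
      (⟨castSite (x - unitVec ⟨0, h0⟩), ⟨0, h0⟩⟩ : PBond (F.P Kt) (k i)))
    (hN5 : ∀ i κ, ((hi i κ - lo i κ + 1).toNat : ℤ) + 5 < (F.P Kt).sitesPerDir (k i))
    (ext : ∀ i, GaugeField (F.P Kt) (k i) SU2 → GaugeField (F.P Kt) (k i) SU2)
    (hext : ∀ i Vk, ext i Vk = extend (pts (k i) (Λ i)) (shellGauge Vk (lo i) (hi i)) Vk)
    (hlohi : ∀ i, lo i ≤ hi i)
    {γ cJ bx : ℝ} (hγ : 0 < γ) (hcJ : 0 ≤ cJ) (hbx : 0 ≤ bx)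
    (hbxM : ∀ i, 12 * ((F.P Kt).d : ℝ) * ((n i : ℝ) + 2) ^ 2 ≤ bx * (M i) ^ 2)
    {R 𝓐₀ : ι → ℝ} (hM : ∀ i, 1 ≤ (M i)) (hR : ∀ i, 0 < R i) (h𝓐₀ : ∀ i, 0 ≤ 𝓐₀ i)
    -- (J0′) ONE family along the chart family with ℂ-differentiable bounded matrix entries which at every real point IS SOME (2.12) MINIMISER of that
    -- point's datum in the class of record — print's object `U_k(V′)` of [15] Prop. 9 (190); intrinsic (not pinned to the selector `UminOfRecord`)
    (hMin : ∀ i Vk, PlaqSmallOn (plaqsInside (pts (k i) (Z i ∩ (Λ i)ᶜ))) (eR i) Vk →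
      ∃ Ũ : VecField (F.P Kt) (k i) (EuclideanSpace ℂ (Fin 3)) × VecField (F.P Kt) (k i) (EuclideanSpace ℂ (Fin 3)) →
          PBond (F.P Kt) 0 → Matrix (Fin 2) (Fin 2) ℂ,
        (∀ b a c, DifferentiableOn ℂ (fun z => Ũ z b a c) (ball 0 (R i))) ∧
        (∀ z ∈ ball (0 : VecField (F.P Kt) (k i) (EuclideanSpace ℂ (Fin 3)) × VecField (F.P Kt) (k i) (EuclideanSpace ℂ (Fin 3))) (R i),
          ∀ b a c, ‖Ũ z b a c‖ ≤ 𝓐₀ i) ∧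
        ∀ p B' : VecField (F.P Kt) (k i) E3, ‖p‖ < R i → ‖B'‖ < R i → ∃ U' : GaugeField (F.P Kt) 0 SU2,
          (∀ b, Ũ (cplxVec p, cplxVec B') b = ((U' b : SU2) : Matrix (Fin 2) (Fin 2) ℂ)) ∧
            IsMinimizer (Node00.avOfRecord F 2 Kt) (Node00.regMSCoPOfRecord F 2 ν Kt (k i) (maxDomT ν.M₁ (Z i))) (Bj ν.M₁ (Z i) (k i))
              (avgFamily (Node00.avOfRecord F 2 Kt) (qsstarGIter0 (k i) (expMul su2Chart B' (ext i (expMul su2Chart p Vk))))) U')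
    -- (L2) = (1.9) p.358 AS THE LETTER: coercivity of the slice Hessian `D(∇ sliceFn)(0)` at `eR`-regular data (dag-n12-c's `hcoer`; replaces `{γ₀} h17 hsm hγle`)
    (hcoer : ∀ i Vk, PlaqSmallOn (plaqsInside (pts (k i) (Z i ∩ (Λ i)ᶜ))) (eR i) Vk → ∀ X : GaugeSlice (pts (k i) (Λ i)) (T i) E3,
      γ / (M i) ^ 5 * ‖X‖ ^ 2 ≤ ⟪X, (fderiv ℝ (rGrad (pts (k i) (Λ i)) (T i)
              (sliceFn (pts (k i) (Λ i)) (T i)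
                (fun177std (Node00.bgMSCoPOfRecord F 2 ν Kt (k i) (maxDomT ν.M₁ (Z i))) ν.M₁ (Z i) (k i)) (ext i Vk))) 0) X⟫)
    -- the geometric letter: the k-blocks over the bonds meeting `Λ^{(k)}` lie inside `Ω₁(Z)`
    (hfar : ∀ i (b : PBond (F.P Kt) 0), b.src ∉ maxDomT ν.M₁ (Z i) 1 →
      (⟨blockIter (k i) b.src, b.dir⟩ : PBond (F.P Kt) (k i)) ∉ bondsOf (pts (k i) (Λ i)))
    -- (Gᵃ) geometry of `Z`: a union of `k`-blocks
    (hZblk : ∀ i, IsBlockUnion (k i) (Z i))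
    -- print's `M₁ ≥ 2` and the torus divisibility `L^{k}M₁ ∣ 2L^{m+K}`
    (hM2 : 2 ≤ ν.M₁) (hdiv : ∀ i, side (F.P Kt).L ν.M₁ (k i) ∣ (F.P Kt).sitesPerDir 0)
    -- bookkeeping constants
    {cE B₃ a₀ a₁' cA : ℝ} (hcE0 : 0 ≤ cE) (hcE : ∀ i, 12 * ((F.P Kt).d : ℝ) * ((n i : ℝ) + 2) ^ 2 ≤ cE) (hB₃ : 0 ≤ B₃)
    (heRa : ∀ i, (cE + 1) * eR i ≤ a₁' ∧ B₃ * ((cE + 1) * eR i) ≤ ν.εreg) (ha₀ : ν.εreg ≤ a₀)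
    (hcA : ∀ i, 1 / 2 * (B₃ * (cE + 1) * (F.P Kt).eta 1 ^ 2) ^ 2 * (Nat.card {q : Plaq (F.P Kt) 0 // q ∈ plaqsOf (maxDomT ν.M₁ (Z i) 1)} : ℝ) ≤ cA)
    -- [15] THEOREM 1 (R) = (8) OVER NODE 00's TORUS CLASS (shape (C)), READ AT EACH INSTANCE's OWN LENGTH `k i`
    (h15T : ∀ (i : ι) (s : B14.Eq218Concrete.Seq (fun n : ℕ => Node00.unionsOfCubes (F.P Kt) (side (F.P Kt).L ν.M₁ n)) (k i)),
      Node00.Sect2.SeqSeparated ν.M₁ s → 0 < ν.M₁ →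
      ∀ (ε₀ : ℝ) (δ : ℕ → ℝ), (∀ j, j ≤ k i → 0 < δ j ∧ δ j ≤ a₁' ∧ B₃ * δ j ≤ ε₀) → (∀ j, j < k i → δ j ≤ 2 * δ (j + 1)) →
      (∀ j, j < k i → δ (j + 1) ≤ 2 * δ j) → ε₀ ≤ a₀ →
      ∀ W : MSField (F.P Kt) SU2,
        Node00.Sect2.DataSmall7PTop (Node00.avOfRecord F 2 Kt) s.Ω (Node00.suppDomOfRecord F ν Kt s.Ω) (k i) δ W →
        ∀ U₀ : GaugeField (F.P Kt) 0 SU2, IsMinimizer (Node00.avOfRecord F 2 Kt)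
            {U | (∀ j, j ≤ k i → PlaqSmallOn (Node00.Sect2.omegaPlaqsTop s.Ω (Node00.suppDomOfRecord F ν Kt s.Ω) j)
                (ε₀ * (F.P Kt).eta j ^ 2) U) ∧
              Node00.Sect2.CoDivClassOnTop s.Ω (Node00.suppDomOfRecord F ν Kt s.Ω) (k i) ε₀ U}
            (genSet s.Ω (k i)) W U₀ →
          (∀ j, j ≤ k i → PlaqSmallOn (Node00.Sect2.omegaPlaqsTop s.Ω (Node00.suppDomOfRecord F ν Kt s.Ω) j)
              (B₃ * δ j * (F.P Kt).eta j ^ 2) U₀) ∧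
            ∀ j, j ≤ k i → Node00.Sect2.CoDivSmallOn (Node00.Sect2.omegaBondsTop s.Ω (Node00.suppDomOfRecord F ν Kt s.Ω) j)
              (B₃ * δ j * (F.P Kt).eta j ^ 3) U₀)
    (hcJ' : ∀ i, 2 * cA * eR i / R i + 2 * ((Nat.card {q : Plaq (F.P Kt) 0 // q ∈ plaqsOf (maxDomT ν.M₁ (Z i) 1)} : ℝ) * (1 + 8 * 𝓐₀ i ^ 4)) / (R i * eR i) ≤ cJ)
    : ∃ a₁ : ι → ℝ, (∀ i, 0 < a₁ i) ∧
      B15.Prop1Printed (lfVarOn su2Chart fun i =>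
        InstOn.std (Node00.bgMSCoPOfRecord F 2 ν Kt (k i) (maxDomT ν.M₁ (Z i))) ν.M₁ (Z i) (Λ i) (k i) (M i) (a₁ i)
          (anExt (pts (k i) (Λ i)) (T i)
            (fun177std (Node00.bgMSCoPOfRecord F 2 ν Kt (k i) (maxDomT ν.M₁ (Z i))) ν.M₁ (Z i) (k i)) (ext i)
            (min (1 / 2) (min (R i / 8) (γ / (M i) ^ 5 * (R i / 2) ^ 2 /
              (48 * (4 * ((Nat.card {q : Plaq (F.P Kt) 0 // q ∈ plaqsOf (maxDomT ν.M₁ (Z i) 1)} : ℝ) * (1 + 8 * 𝓐₀ i ^ 4)) / R i + 1))))))) := by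
  -- Proposition 1 with the clause at the TOTAL radius: the `_nearExt` head
  obtain ⟨a₁, ha₁, hP⟩ :=
    exists_domain_prop1Printed_lfVarOn_std_su2_box_intrinsic_analytic_atZSeqCoPRecord_ofThm1AtLength_ofMinimiserFamily_ofCoercive_nearExt ν Kt hd3 h0 hcl Z Λ k M
      hk0 hk eR heR T lo hi n hn hN hbox hZ hTG0 hN5 ext hext hlohi hγ hcJ hbx hbxM hM hR h𝓐₀ hMin hcoer hfar hZblk hM2 hdiv hcE0 hcE hB₃ heRa ha₀ hcA h15T hcJ'
  subst hcl
  letI hcls : ∀ j, DecidableEq (PBond (F.P Kt) j) := fun _ a b => Classical.propDecidable (a = b)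
  refine ⟨a₁, ha₁, prop1Printed_lfVarOn_std_of_An su2Chart (fun i => Node00.bgMSCoPOfRecord F 2 ν Kt (k i) (maxDomT ν.M₁ (Z i))) (fun _ => ν.M₁)
    Z Λ k M a₁ _ _ hP fun i => ?_⟩
  -- the two functions: print's (1.77) and its near part
  set f : ∀ i, GaugeField (F.P Kt) (k i) SU2 → ℝ := fun i =>
    fun177std (Node00.bgMSCoPOfRecord F 2 ν Kt (k i) (maxDomT ν.M₁ (Z i))) ν.M₁ (Z i) (k i) with hfdef
  set fh : ∀ i, GaugeField (F.P Kt) (k i) SU2 → ℝ := fun i V =>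
    wilsonLoc ((plaqsOf (maxDomT ν.M₁ (Z i) 1)).indicator fun _ => (1 : ℝ))
      (bgKZstd (Node00.bgMSCoPOfRecord F 2 ν Kt (k i) (maxDomT ν.M₁ (Z i))) ν.M₁ (Z i) (k i) V) with hfhdef
  -- (J1) and (J1ˢ) from (J0′); the dichotomy; (Vn) from `h15T`; the gradient row
  have hGj := fun i Vk (hV : PlaqSmallOn (plaqsInside (pts (k i) (Z i ∩ (Λ i)ᶜ))) (eR i) Vk) =>
    jointHolomorphic_fun177std_bgMSCoPOfRecord_of_minimiserFamily ν Kt (k i) (maxDomT ν.M₁ (Z i)) ν.M₁ (Z i) (k i) (ext i) Vk (hMin i Vk hV)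
  have hGjS := fun i Vk (hV : PlaqSmallOn (plaqsInside (pts (k i) (Z i ∩ (Λ i)ᶜ))) (eR i) Vk) =>
    jointHolomorphic_nearValue_bgMSCoPOfRecord_of_minimiserFamily ν Kt (k i) (maxDomT ν.M₁ (Z i)) ν.M₁ (Z i) (k i) (hk0 i) (ext i) Vk (h𝓐₀ i) (hMin i Vk hV)
  have hVn := nearValue_letter_of_thm1AtLength_nearCount ν Kt hd3 Z Λ k hk0 hk eR lo hi n hn hbox hZ hN5 ext hext hlohi hZblk hM2 hdiv hcE0 hcE hB₃
    heRa ha₀ hcA h15T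
  have hJ := hJ_of_nearValue_nearExt Z Λ k f fh
    (fun _ _ => wilsonLoc_nonneg _ _ fun p => Set.indicator_nonneg (fun _ _ => zero_le_one) p) eR heR T ext hR hGj hGjS
    (fun i Vk _ => fun177std_dichotomy (Node00.avOfRecord F 2 Kt)
      (Node00.regMSCoPOfRecord F 2 ν Kt (k i) (maxDomT ν.M₁ (Z i))) ν.M₁ (hk0 i) (hk i) (T i) (hfar i) (ext i Vk))
    hVn hcJ'
  -- the near radius bookkeeping
  have h𝓐S : 0 ≤ (Nat.card {q : Plaq (F.P Kt) 0 // q ∈ plaqsOf (maxDomT ν.M₁ (Z i) 1)} : ℝ) * (1 + 8 * 𝓐₀ i ^ 4) := by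
    have := h𝓐₀ i; positivity
  obtain ⟨hc, hrA0, hrA2, hrr', hr'R, hr'c, hεA0, hεr', hεc, heJ0, hcJe, hrAR⟩ := near_radii_bookkeeping (hR i) h𝓐S hγ (hM i) hcJ
  set 𝓐S : ℝ := (Nat.card {q : Plaq (F.P Kt) 0 // q ∈ plaqsOf (maxDomT ν.M₁ (Z i) 1)} : ℝ) * (1 + 8 * 𝓐₀ i ^ 4) with h𝓐Sdef
  set rA : ℝ := min (1 / 2) (min (R i / 8) (γ / (M i) ^ 5 * (R i / 2) ^ 2 / (48 * (4 * 𝓐S / R i + 1)))) with hrAdef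
  set εA : ℝ := min (2 * rA) (γ / (M i) ^ 5 * (2 * rA) * (R i / 2) / (12 * (4 * 𝓐S / R i + 1))) with hεAdef
  set eJ : ℝ := γ / (M i) ^ 5 * (2 * rA) / (6 * (cJ + 1)) with heJdef
  refine ⟨min (eR i) (min εA eJ), lt_min (heR i) (lt_min hεA0 heJ0), fun ε hε hεe Vk hV => ?_⟩
  have hVR : PlaqSmallOn (plaqsInside (pts (k i) (Z i ∩ (Λ i)ᶜ))) (eR i) Vk := fun q hq => (hV q hq).trans_le (hεe.trans (min_le_left _ _))
  refine anExt_antitone (hεe.trans ((min_le_right _ _).trans (min_le_left _ _))) ?_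
  obtain ⟨𝒢, hd, hb, hr⟩ := hGj i Vk hVR
  obtain ⟨𝒢S, hdS, hbS, hrS⟩ := hGjS i Vk hVR
  -- the slice tree `G₀` gauge-fixes `Λ^{(k)}`
  have hNw : ∀ κ, hi i κ - lo i κ + 1 < ((F.P Kt).sitesPerDir (k i) : ℤ) := fun κ => by
    have h5 := hN5 i κ
    have : hi i κ - lo i κ + 1 ≤ ((hi i κ - lo i κ + 1).toNat : ℤ) := Int.self_le_toNat _
    linarith
  have hT' : TreeOrder (T i) PBond.tgt (boxDepth (lo i - e ⟨0, h0⟩) (hi i)) := by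
    rw [hTG0 i]; exact treeOrder_G0 h0 hNw
  have hv : ∀ b ∈ T i, b.tgt ∈ pts (k i) (Λ i) := fun b hb => by
    rw [hbox i]; rw [hTG0 i] at hb; exact tgt_G0_mem h0 (lo i) (hi i) b hb
  -- (181): the value invariance of (1.77)
  have hfinv : ∀ u : GaugeTransf (F.P Kt) (k i) SU2, IsGaugeOn (pts (k i) (Λ i)) u → ∀ V, f i (gaugeAct u V) = f i V := fun u _ V =>
    fun177std_bgOfRecord_gaugeAct (Node00.avOfRecord F 2 Kt)
      (B15Eq177ValueInvarianceCoDiv.gaugeAct_mem_regMSCoPOfRecord ν Kt (k i) (maxDomT ν.M₁ (Z i))) ν.M₁ (Z i) (hk i) u V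
  -- the transfer letter, discharged from the real points of (J0′)
  have htr : ∀ p : VecField (F.P Kt) (k i) E3, ‖p‖ < R i → ∃ C : ℝ, ∀ W : GaugeField (F.P Kt) (k i) SU2,
      (∀ b, b ∉ bondsOf (pts (k i) (Λ i)) → W b = ext i (expMul su2Chart p Vk) b) →
        (∀ b, dist1 (W b * (ext i (expMul su2Chart p Vk) b)⁻¹) < R i / 2) → f i W = fh i W + C := fun p hp => by
    obtain ⟨Ũ, -, -, hreal⟩ := hMin i Vk hVR
    exact transferLetter_of_minimiserFamily (Node00.avOfRecord F 2 Kt) (Node00.regMSCoPOfRecord F 2 ν Kt (k i) (maxDomT ν.M₁ (Z i))) ν.M₁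
      (hk0 i) (hk i) (hfar i) (ext i (expMul su2Chart p Vk)) (hR i)
      fun B' hB' => (hreal p B' hp hB').elim fun U' hU' => ⟨U', hU'.2⟩
  -- the gradient row at the datum
  have hj := (hJ i ε Vk hε (hεe.trans (min_le_left _ _)) hV).trans (mul_le_mul_of_nonneg_left hεe hcJ)
  have hjc : cJ * min (eR i) (min εA eJ) ≤ γ / (M i) ^ 5 * (2 * rA) / 6 :=
    (mul_le_mul_of_nonneg_left ((min_le_right _ _).trans (min_le_right _ _)) hcJ).trans hcJe
  exact anExt_nearRadius_of_jointHolomorphic hT' hv (f i) (fh i) hfinv (ext i) Vk (hR i) h𝓐S 𝒢 hd hb hr 𝒢S hdS hbS hrS htr hc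
    (hcoer i Vk hVR) hj hrA0 hrr' hr'R hr'c hεr' hεc hjc hrA2 (by linarith [hR i])


end AtRecordNearRadius

end Literature.MathematicalPhysics.QuantumFieldTheory.Balaban1983to89.B15Prop1CoerciveEditionNearAtLength

end
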